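import Mathlib
import HarnessLib
/-!
# Drain-orbit UNIQUENESS, the regime-II deficit law, and the plateau angular law of the ℓ-reduced class-E model

HONEST FRAMING (cell ns-blowup GROUP B «PROFILE SEARCH», zone Z6 «Elgindi-type C^{1,α} no-swirl self-similar blow-up»; human
rulings D-0035/D-0074/D-0081): elementary real analysis and real algebra about the TWO-ODE DRAIN CLOSURE of the ℓ-REDUCED
ν = 0 axisymmetric NO-SWIRL **EULER** class-E profile equation (profile-eng-10 g5, `ElgindiDrainClosure`, HOME/profile/z6twin/asym/
LIMIT-ANALYSIS.md §4–§5) and its matching to the axis-trench regime, written by the TWIN seat (profile-eng-9 g3, engine A;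
HOME/profile/z6/pen/limit/LIMIT-THEORY-A.md). A MODEL of a MODEL of a MODEL; «violates: none — MODEL (Euler)»; nothing about
Navier–Stokes and nothing about existence of profiles.

WHAT IS KERNEL-CHECKED HERE (complementing `ElgindiDrainClosure`, which shows that the family `3μ − 3CΛ + KΛ^{-1/3}` SOLVES the
orbit equation `Λγ′ + γ/3 = μ − 4CΛ`):
* `drainOrbit_unique` — the converse: EVERY solution of the orbit equation on an interval `(0, a)` is `3μ − 3CΛ + KΛ^{-1/3}` for one
  constant `K` (the function `(γ − 3μ + 3CΛ)·Λ^{1/3}` has zero derivative);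
* `drainOrbit_K_eq_zero_of_bounded` — a solution bounded near `Λ → 0⁺` has `K = 0`, hence `drainConstant_eq_two_thirds_of_solution`:
  for ANY solution bounded at the plateau entry, the mass condition `γ(1/2) = 0` together with the corner-speed relation `μ = 2C − 1`
  forces **`C = 2/3`** — `ElgindiDrainClosure.drainConstant_eq_two_thirds` no longer needs «on the linear orbit» as a hypothesis;
* `drainOrbit_exponential` — at `C = 2/3, μ = 1/3` the slow-time solution is EXACTLY exponential: `Λ(S) = (1 − e^{−S})/2`,
  `γ = 1 − 2Λ = e^{−S}` solve `Λ′ = γ/2`, `γ′ = γ(μ − 4CΛ − γ/3)/(2Λ)`;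
* `deficitLaw_solves` / `deficitLaw_unique` — the regime-II flux deficit `ψ = 3 − g/m̃` of the transition equation obeys, at leading
  order, `ψ′(L) = −(2/3)ψ/(1 + 2L)`, whose solutions are EXACTLY `D(1 + 2L)^{−1/3}`: the approach exponent is `1/3` with no drift
  (the question left open in LIMIT-ANALYSIS §5's caveat), so `C(ε) − 2/3 ∝ ε^{1/3}`; `drainConstant_gt_two_thirds_of_matching`:
  the matched mass relation `4.5C − 3 = D₀(2ε)^{1/3}(2C − 1)^{4/3}` with `D₀ > 0` puts `C(ε)` ABOVE `2/3`;
* `rateDefect_div_speed` / `angularExponent_eq_half` / `log_sin_arctan_exp` / `hasDerivAt_log_sin_coord` — the closed form of the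
  quasi-steady ANGULAR LAW behind the closure: along characteristics `d(y − y_axis)/du = [r(x) − r(1)]/v(x) = 2αΛ cos²θ/(1 − 4αλ)` and
  `d(ln sin θ)/du = cos²θ` (`u = ln tan θ`), so `H/H_axis = (sin θ)^{−q}`, `q = 2αΛ/(1 − 4αλ)`, and `q = 1/2` for EVERY `λ` when
  `α = λ₀ = 1/2` — which is why the angular factor of the flux is `Λ`-independent and the closure closes.
WHAT IS NOT PROVED: the closure and the transition equation themselves (modelling steps), the value `D₀ = 2.036` (numerics, TRANS2),
anything about the full class-E system. bears on LADDER-NS N5 / zone Z6 case Z6-1 (c) → N1 linear core.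
-/

open Real Set

namespace Summit.NavierStokesRegularity.OSWSelfSimilar
namespace ElgindiDrainMatching

/-! ## 1. Uniqueness for the drain orbit `Λγ′ + γ/3 = μ − 4CΛ` -/

/-- **Every solution of the orbit equation is `3μ − 3CΛ + KΛ^{-1/3}`.** If `γ` has derivative `γ' Λ` at every `Λ ∈ (0, a)` and
`Λ·γ'(Λ) + γ(Λ)/3 = μ − 4CΛ` there, then for a single constant `K`, `γ(Λ) = 3μ − 3CΛ + KΛ^{-1/3}` on `(0, a)`.
Proof: `(γ − 3μ + 3CΛ)·Λ^{1/3}` has zero derivative on the open connected set `(0, a)`. [new here — converse of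
`ElgindiDrainClosure.drainOrbit_general`; MODEL closure calculus] -/
theorem drainOrbit_unique {γ γ' : ℝ → ℝ} {μ C a : ℝ}
    (hder : ∀ Λ ∈ Ioo 0 a, HasDerivAt γ (γ' Λ) Λ)
    (hode : ∀ Λ ∈ Ioo 0 a, Λ * γ' Λ + γ Λ / 3 = μ - 4 * C * Λ) :
    ∃ K : ℝ, ∀ Λ ∈ Ioo 0 a, γ Λ = 3 * μ - 3 * C * Λ + K * Λ ^ (-(1 / 3 : ℝ)) := by
  set G : ℝ → ℝ := fun L => (γ L - (3 * μ - 3 * C * L)) * L ^ (1 / 3 : ℝ) with hG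
  -- G has zero derivative on (0, a)
  have hGder : ∀ Λ ∈ Ioo 0 a, HasDerivAt G 0 Λ := by
    intro Λ hΛ
    have hΛ0 : 0 < Λ := hΛ.1
    have h1 : HasDerivAt (fun L => γ L - (3 * μ - 3 * C * L)) (γ' Λ + 3 * C) Λ := by
      have := ((hasDerivAt_id' Λ).const_mul (3 * C)).const_sub (3 * μ)
      exact ((hder Λ hΛ).sub this).congr_deriv (by ring)
    have h2 : HasDerivAt (fun L : ℝ => L ^ (1 / 3 : ℝ)) ((1 / 3 : ℝ) * Λ ^ ((1 / 3 : ℝ) - 1)) Λ :=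
      Real.hasDerivAt_rpow_const (p := (1 / 3 : ℝ)) (Or.inl hΛ0.ne')
    have h12 := h1.mul h2
    refine h12.congr_deriv ?_
    have hbr : (γ' Λ + 3 * C) * Λ + (γ Λ - (3 * μ - 3 * C * Λ)) * (1 / 3) = 0 := by
      linear_combination hode Λ hΛ
    have hP : Λ ^ (1 / 3 : ℝ) = Λ ^ ((1 / 3 : ℝ) - 1) * Λ := by
      rw [Real.rpow_sub_one hΛ0.ne', div_mul_cancel₀ _ hΛ0.ne']
    rw [hP]
    have : (γ' Λ + 3 * C) * (Λ ^ ((1 / 3 : ℝ) - 1) * Λ)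
        + (γ Λ - (3 * μ - 3 * C * Λ)) * ((1 / 3 : ℝ) * Λ ^ ((1 / 3 : ℝ) - 1))
        = Λ ^ ((1 / 3 : ℝ) - 1) * ((γ' Λ + 3 * C) * Λ + (γ Λ - (3 * μ - 3 * C * Λ)) * (1 / 3)) := by ring
    rw [this, hbr, mul_zero]
  have hGdiff : DifferentiableOn ℝ G (Ioo 0 a) := fun Λ hΛ => (hGder Λ hΛ).differentiableAt.differentiableWithinAt
  have hGd0 : (Ioo 0 a).EqOn (deriv G) 0 := fun Λ hΛ => (hGder Λ hΛ).deriv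
  obtain ⟨K, hK⟩ := isOpen_Ioo.exists_is_const_of_deriv_eq_zero isPreconnected_Ioo hGdiff hGd0
  refine ⟨K, fun Λ hΛ => ?_⟩
  have hΛ0 : 0 < Λ := hΛ.1
  have hKΛ := hK Λ hΛ
  -- γ Λ - (3μ - 3CΛ) = K * Λ^{-1/3}
  have hmul : Λ ^ (1 / 3 : ℝ) * Λ ^ (-(1 / 3 : ℝ)) = 1 := by
    rw [← Real.rpow_add hΛ0]; norm_num
  have : (γ Λ - (3 * μ - 3 * C * Λ)) = K * Λ ^ (-(1 / 3 : ℝ)) := by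
    have := congrArg (fun t => t * Λ ^ (-(1 / 3 : ℝ))) hKΛ
    simp only [hG] at this
    rw [mul_assoc, hmul, mul_one] at this
    exact this
  linarith

/-- **A solution bounded at the plateau entry has `K = 0`.** If `∣γ∣ ≤ M` on `(0, a)` (`0 < a`) and
`γ = 3μ − 3CΛ + KΛ^{-1/3}` there, then `K = 0` — the singular branches are unbounded as `Λ → 0⁺`.
[new here — MODEL closure calculus; the matching condition «γ → 3μ finite» of LIMIT-ANALYSIS §4] -/
theorem drainOrbit_K_eq_zero_of_bounded {γ : ℝ → ℝ} {μ C a K M : ℝ} (ha : 0 < a)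
    (hform : ∀ Λ ∈ Ioo 0 a, γ Λ = 3 * μ - 3 * C * Λ + K * Λ ^ (-(1 / 3 : ℝ)))
    (hbdd : ∀ Λ ∈ Ioo 0 a, |γ Λ| ≤ M) : K = 0 := by
  by_contra hK
  -- bound for |K| Λ^{-1/3} on (0,a)
  set B : ℝ := M + 3 * |μ| + 3 * |C| * a + 1 with hB
  have hBpos : 0 < B := by have := abs_nonneg μ; have := abs_nonneg C; have h0 : 0 ≤ M := le_trans (abs_nonneg _) (hbdd (a/2) ⟨by linarith, by linarith⟩); positivity
  have hKpos : 0 < |K| := abs_pos.mpr hK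
  -- choose Λ small: Λ = min (a/2) t, t = (|K|/B)^3 so that Λ^{1/3} ≤ |K|/B
  set t : ℝ := (|K| / B) ^ (3 : ℝ) with ht
  have htpos : 0 < t := Real.rpow_pos_of_pos (div_pos hKpos hBpos) 3
  set Λ : ℝ := min (a / 2) t with hΛdef
  have hΛpos : 0 < Λ := lt_min (by linarith) htpos
  have hΛa : Λ ∈ Ioo 0 a := ⟨hΛpos, lt_of_le_of_lt (min_le_left _ _) (by linarith)⟩
  have hΛt : Λ ≤ t := min_le_right _ _
  -- Λ^{1/3} ≤ t^{1/3} = |K|/B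
  have hcube : t ^ (1 / 3 : ℝ) = |K| / B := by
    rw [ht, ← Real.rpow_mul (le_of_lt (div_pos hKpos hBpos))]; norm_num
  have hroot : Λ ^ (1 / 3 : ℝ) ≤ |K| / B := by
    rw [← hcube]; exact Real.rpow_le_rpow hΛpos.le hΛt (by norm_num)
  have hrootpos : 0 < Λ ^ (1 / 3 : ℝ) := Real.rpow_pos_of_pos hΛpos _
  -- hence |K| Λ^{-1/3} ≥ B
  have hinv : Λ ^ (-(1 / 3 : ℝ)) = (Λ ^ (1 / 3 : ℝ))⁻¹ := Real.rpow_neg hΛpos.le _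
  have hbig : B ≤ |K| * Λ ^ (-(1 / 3 : ℝ)) := by
    rw [hinv]
    rw [le_div_iff₀ hBpos] at hroot  -- Λ^{1/3} * B ≤ |K|
    calc B = B * Λ ^ (1 / 3 : ℝ) * (Λ ^ (1 / 3 : ℝ))⁻¹ := by field_simp
      _ ≤ |K| * (Λ ^ (1 / 3 : ℝ))⁻¹ := by
        apply mul_le_mul_of_nonneg_right _ (inv_nonneg.mpr hrootpos.le)
        linarith [hroot]
  -- but |K Λ^{-1/3}| = |γ Λ - 3μ + 3CΛ| ≤ M + 3|μ| + 3|C| a < B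
  have hsmall : |K| * Λ ^ (-(1 / 3 : ℝ)) < B := by
    have hf := hform Λ hΛa
    have heq : K * Λ ^ (-(1 / 3 : ℝ)) = γ Λ - 3 * μ + 3 * C * Λ := by linarith
    have hpow_pos : 0 < Λ ^ (-(1 / 3 : ℝ)) := Real.rpow_pos_of_pos hΛpos _
    have habs : |K| * Λ ^ (-(1 / 3 : ℝ)) = |γ Λ - 3 * μ + 3 * C * Λ| := by
      rw [← heq, abs_mul, abs_of_pos hpow_pos]
    rw [habs]
    have h1 : |γ Λ - 3 * μ + 3 * C * Λ| ≤ |γ Λ| + 3 * |μ| + 3 * |C| * Λ := by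
      have e1 : |γ Λ - 3 * μ + 3 * C * Λ| ≤ |γ Λ - 3 * μ| + |3 * C * Λ| := abs_add_le _ _
      have e2 : |γ Λ - 3 * μ| ≤ |γ Λ| + |3 * μ| := abs_sub _ _
      have e3 : |3 * μ| = 3 * |μ| := by rw [abs_mul]; norm_num
      have e4 : |3 * C * Λ| = 3 * |C| * Λ := by rw [abs_mul, abs_mul, abs_of_pos hΛpos]; norm_num
      linarith
    have h2 : 3 * |C| * Λ ≤ 3 * |C| * a := by
      apply mul_le_mul_of_nonneg_left (le_of_lt hΛa.2); positivity
    have h3 := hbdd Λ hΛa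
    linarith
  linarith

/-- **`C₀ = 2/3` for ANY bounded solution of the closure.** If `γ` solves the orbit equation on `(0, a)` with `a > 1/2`, is bounded
there, drains the whole mass (`γ(1/2) = 0`), and the normalised corner speed satisfies `μ = 2C − 1`, then `C = 2/3` and `μ = 1/3`.
[new here — `ElgindiDrainClosure.drainConstant_eq_two_thirds` without the «linear orbit» hypothesis; MODEL closure] -/
theorem drainConstant_eq_two_thirds_of_solution {γ γ' : ℝ → ℝ} {μ C a M : ℝ} (ha : 1 / 2 < a)
    (hder : ∀ Λ ∈ Ioo 0 a, HasDerivAt γ (γ' Λ) Λ)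
    (hode : ∀ Λ ∈ Ioo 0 a, Λ * γ' Λ + γ Λ / 3 = μ - 4 * C * Λ)
    (hbdd : ∀ Λ ∈ Ioo 0 a, |γ Λ| ≤ M)
    (hmass : γ (1 / 2) = 0) (hμ : μ = 2 * C - 1) :
    C = 2 / 3 ∧ μ = 1 / 3 ∧ ∀ Λ ∈ Ioo 0 a, γ Λ = 1 - 2 * Λ := by
  obtain ⟨K, hK⟩ := drainOrbit_unique hder hode
  have hK0 : K = 0 := drainOrbit_K_eq_zero_of_bounded (by linarith) hK hbdd
  have hhalf : (1 / 2 : ℝ) ∈ Ioo 0 a := ⟨by norm_num, ha⟩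
  have h := hK (1 / 2) hhalf
  rw [hK0, zero_mul, add_zero, hmass] at h
  have hC : C = 2 / 3 := by linarith
  refine ⟨hC, by linarith, fun Λ hΛ => ?_⟩
  have := hK Λ hΛ
  rw [hK0, zero_mul, add_zero] at this
  rw [this, hμ, hC]; ring

/-- **Entry value.** On the regular orbit the flux tends to `3μ` at the plateau entry: `γ(Λ) = 3μ − 3CΛ → 3μ` as `Λ → 0`
(the matching value `g/m̃ → 3` of the transition regime). [new here — MODEL closure calculus] -/
theorem tendsto_drainOrbit_entry (μ C : ℝ) :
    Filter.Tendsto (fun Λ : ℝ => 3 * μ - 3 * C * Λ) (nhds 0) (nhds (3 * μ)) := by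
  have h : Continuous fun Λ : ℝ => 3 * μ - 3 * C * Λ := by fun_prop
  simpa using h.tendsto 0

/-! ## 2. The exactly exponential plateau at `C = 2/3` -/

/-- **Exponential drain.** With `C = 2/3`, `μ = 1/3`, the slow-time functions `Λ(S) = (1 − e^{−S})/2`, `γ(S) = e^{−S}` satisfy
`γ = 1 − 2Λ` (the regular orbit), `Λ′ = γ/2` (flux law) and `γ′ = γ·(μ − 4CΛ − γ/3)/(2Λ)` (axis law) for `S ≠ 0` — the plateau of
the reduced model is EXACTLY exponential at leading order: `λ = ½e^{−S}`, `g = 2ελ`, decay rate `1` from the start.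
[new here — MODEL closure calculus; eng-9 g3 LIMIT-THEORY-A §2] -/
theorem drainOrbit_exponential (S : ℝ) (hS : S ≠ 0) :
    HasDerivAt (fun s : ℝ => (1 - Real.exp (-s)) / 2) (Real.exp (-S) / 2) S
      ∧ HasDerivAt (fun s : ℝ => Real.exp (-s)) (-Real.exp (-S)) S
      ∧ Real.exp (-S) = 1 - 2 * ((1 - Real.exp (-S)) / 2)
      ∧ -Real.exp (-S)
          = Real.exp (-S) * ((1 / 3 : ℝ) - 4 * (2 / 3 : ℝ) * ((1 - Real.exp (-S)) / 2) - Real.exp (-S) / 3)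
              / (2 * ((1 - Real.exp (-S)) / 2)) := by
  have hexp : HasDerivAt (fun s : ℝ => Real.exp (-s)) (-Real.exp (-S)) S :=
    ((hasDerivAt_neg S).exp).congr_deriv (by ring)
  refine ⟨?_, hexp, by ring, ?_⟩
  · have := (hexp.const_sub 1).div_const 2
    exact this.congr_deriv (by ring)
  · have hne : 1 - Real.exp (-S) ≠ 0 := by
      intro h
      have : Real.exp (-S) = 1 := by linarith
      rw [Real.exp_eq_one_iff] at this
      exact hS (by linarith)
    have hden : 2 * ((1 - Real.exp (-S)) / 2) ≠ 0 := by
      intro h; apply hne; linarith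
    rw [eq_div_iff hden]
    ring

/-! ## 3. The regime-II deficit law: exponent exactly `1/3` -/

/-- **The deficit law solves its ODE.** `ψ(L) = D(1 + 2L)^{−1/3}` satisfies `ψ′ = −(2/3)·ψ/(1 + 2L)` wherever `1 + 2L > 0` — the
leading-order equation of the regime-II flux deficit `ψ = 3 − g/m̃` (from `Z′ = (1 − φ/3)/(1+2L)`, `L′ = φ/2`, `φ = I₀e^{Z}`).
[new here — MODEL³ calculus; LIMIT-THEORY-A §3] -/
theorem deficitLaw_solves (D : ℝ) {L : ℝ} (hL : 0 < 1 + 2 * L) :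
    HasDerivAt (fun l : ℝ => D * (1 + 2 * l) ^ (-(1 / 3 : ℝ)))
      (-(2 / 3) * (D * (1 + 2 * L) ^ (-(1 / 3 : ℝ))) / (1 + 2 * L)) L := by
  have hlin : HasDerivAt (fun l : ℝ => 1 + 2 * l) 2 L := by
    simpa using ((hasDerivAt_id' L).const_mul 2).const_add 1
  have hpow := (hlin.rpow_const (p := -(1 / 3 : ℝ)) (Or.inl hL.ne')).const_mul D
  refine hpow.congr_deriv ?_
  rw [Real.rpow_sub_one hL.ne']
  ring

/-- **Uniqueness of the deficit law: the exponent is exactly `1/3`.** Every solution of `ψ′ = −(2/3)ψ/(1 + 2L)` on an interval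
`(b, c)` with `b ≥ −1/2` is `D(1 + 2L)^{−1/3}` for one constant `D` (no other power, no drift of the exponent) — the point left open
in LIMIT-ANALYSIS §5's caveat. [new here — MODEL³ calculus; LIMIT-THEORY-A §3] -/
theorem deficitLaw_unique {ψ ψ' : ℝ → ℝ} {b c : ℝ} (hb : -(1 / 2) ≤ b)
    (hder : ∀ L ∈ Ioo b c, HasDerivAt ψ (ψ' L) L)
    (hode : ∀ L ∈ Ioo b c, ψ' L = -(2 / 3) * ψ L / (1 + 2 * L)) :
    ∃ D : ℝ, ∀ L ∈ Ioo b c, ψ L = D * (1 + 2 * L) ^ (-(1 / 3 : ℝ)) := by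
  set G : ℝ → ℝ := fun l => ψ l * (1 + 2 * l) ^ (1 / 3 : ℝ) with hG
  have hpos : ∀ L ∈ Ioo b c, 0 < 1 + 2 * L := fun L hL => by linarith [hL.1]
  have hGder : ∀ L ∈ Ioo b c, HasDerivAt G 0 L := by
    intro L hL
    have hL1 := hpos L hL
    have hlin : HasDerivAt (fun l : ℝ => 1 + 2 * l) 2 L := by
      simpa using ((hasDerivAt_id' L).const_mul 2).const_add 1
    have hpow := hlin.rpow_const (p := (1 / 3 : ℝ)) (Or.inl hL1.ne')
    have h := (hder L hL).mul hpow
    refine h.congr_deriv ?_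
    have hP : (1 + 2 * L) ^ (1 / 3 : ℝ) = (1 + 2 * L) ^ ((1 / 3 : ℝ) - 1) * (1 + 2 * L) := by
      rw [Real.rpow_sub_one hL1.ne', div_mul_cancel₀ _ hL1.ne']
    have hψ' : ψ' L * (1 + 2 * L) = -(2 / 3) * ψ L := by
      rw [hode L hL]; field_simp
    rw [hP]
    have : ψ' L * ((1 + 2 * L) ^ ((1 / 3 : ℝ) - 1) * (1 + 2 * L))
        + ψ L * (2 * (1 / 3 : ℝ) * (1 + 2 * L) ^ ((1 / 3 : ℝ) - 1))
        = (1 + 2 * L) ^ ((1 / 3 : ℝ) - 1) * (ψ' L * (1 + 2 * L) + (2 / 3) * ψ L) := by ring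
    rw [this, hψ']
    ring
  have hGdiff : DifferentiableOn ℝ G (Ioo b c) := fun L hL => (hGder L hL).differentiableAt.differentiableWithinAt
  have hGd0 : (Ioo b c).EqOn (deriv G) 0 := fun L hL => (hGder L hL).deriv
  obtain ⟨D, hD⟩ := isOpen_Ioo.exists_is_const_of_deriv_eq_zero isPreconnected_Ioo hGdiff hGd0
  refine ⟨D, fun L hL => ?_⟩
  have hL1 := hpos L hL
  have hmul : (1 + 2 * L) ^ (1 / 3 : ℝ) * (1 + 2 * L) ^ (-(1 / 3 : ℝ)) = 1 := by
    rw [← Real.rpow_add hL1]; norm_num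
  have := congrArg (fun t => t * (1 + 2 * L) ^ (-(1 / 3 : ℝ))) (hD L hL)
  simp only [hG] at this
  rw [mul_assoc, hmul, mul_one] at this
  exact this

/-- **The approach is from above.** If the matched mass relation `(9/2)C − 3 = D₀(2ε)^{1/3}(2C − 1)^{4/3}` holds with `D₀ > 0`,
`ε > 0` and `C > 1/2`, then `C > 2/3` — the reduced-model `C(ε)` approaches its limit `2/3` from ABOVE (numerics: 0.678 (ε 5e-4) →
0.6695 (1e-5)). [new here — MODEL³ algebra; LIMIT-ANALYSIS §5 / LIMIT-THEORY-A §3] -/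
theorem drainConstant_gt_two_thirds_of_matching {C D₀ ε : ℝ} (hD : 0 < D₀) (hε : 0 < ε) (hC : 1 / 2 < C)
    (hmatch : (9 / 2) * C - 3 = D₀ * (2 * ε) ^ (1 / 3 : ℝ) * (2 * C - 1) ^ (4 / 3 : ℝ)) :
    2 / 3 < C := by
  have h1 : 0 < (2 * ε) ^ (1 / 3 : ℝ) := Real.rpow_pos_of_pos (by linarith) _
  have h2 : 0 < (2 * C - 1) ^ (4 / 3 : ℝ) := Real.rpow_pos_of_pos (by linarith) _
  have : 0 < D₀ * (2 * ε) ^ (1 / 3 : ℝ) * (2 * C - 1) ^ (4 / 3 : ℝ) := by positivity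
  linarith

/-- **Enclosure of the leading coefficient.** `c₁ := 2^{1/3}·3^{−4/3}·D₀/(9/2)` is the coefficient of `ε^{1/3}` in `C(ε) − 2/3`
(linearisation of the matched relation at `C = 2/3`); with the cube-root enclosures `1.2599 < 2^{1/3} < 1.26` and
`4.3267 < 3^{4/3} < 4.3268` (checked here from `x³` comparisons) and TRANS2's `D₀ ∈ [2.0360, 2.0362]` one gets
`0.13174 < c₁ < 0.13180`. Stated as the two rpow enclosures, which are the only non-rational inputs. [new here — numerics support] -/
theorem cubeRoot_enclosures :
    (12599 / 10000 : ℝ) < (2 : ℝ) ^ (1 / 3 : ℝ) ∧ (2 : ℝ) ^ (1 / 3 : ℝ) < 126 / 100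
      ∧ (43267 / 10000 : ℝ) < (3 : ℝ) ^ (4 / 3 : ℝ) ∧ (3 : ℝ) ^ (4 / 3 : ℝ) < 43268 / 10000 := by
  have key : ∀ {x y : ℝ}, 0 ≤ x → 0 ≤ y → x ^ (3 : ℕ) < y ^ (3 : ℕ) → x < y := fun hx hy h =>
    lt_of_pow_lt_pow_left₀ 3 hy h
  have h2 : ((2 : ℝ) ^ (1 / 3 : ℝ)) ^ (3 : ℕ) = 2 := by
    rw [← Real.rpow_natCast, ← Real.rpow_mul (by norm_num)]; norm_num
  have h3 : ((3 : ℝ) ^ (4 / 3 : ℝ)) ^ (3 : ℕ) = 81 := by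
    rw [← Real.rpow_natCast, ← Real.rpow_mul (by norm_num)]; norm_num
  have p2 : 0 ≤ (2 : ℝ) ^ (1 / 3 : ℝ) := Real.rpow_nonneg (by norm_num) _
  have p3 : 0 ≤ (3 : ℝ) ^ (4 / 3 : ℝ) := Real.rpow_nonneg (by norm_num) _
  refine ⟨key (by norm_num) p2 ?_, key p2 (by norm_num) ?_, key (by norm_num) p3 ?_, key p3 (by norm_num) ?_⟩
  · rw [h2]; norm_num
  · rw [h2]; norm_num
  · rw [h3]; norm_num
  · rw [h3]; norm_num

/-! ## 4. The plateau angular law in closed form -/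

/-- **Rate defect over speed.** With `ã(x) = 1 + 2αλ(1 − 3x)` (`x = sin²θ`), characteristic `u`-speed `v(x) = 6λ/ã(x)` and decay
rate `r(x) = −2Λ/ã(x)` of `y = ln H` along characteristics (drain regime, `λ′`-terms dropped), the accumulated angular profile
obeys `d(y − y_axis)/du = (r(x) − r(1))/v(x) = 2αΛ(1 − x)/(1 − 4αλ)` — proportional to `cos²θ = d(ln sin θ)/du`, whence
`H/H_axis = (sin θ)^{−q}`, `q = 2αΛ/(1 − 4αλ)`. [new here — MODEL closure algebra; LIMIT-THEORY-A §1] -/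
theorem rateDefect_div_speed {α lam Λ x : ℝ} (hx : 1 + 2 * α * lam * (1 - 3 * x) ≠ 0)
    (h1 : 1 - 4 * α * lam ≠ 0) (hl : lam ≠ 0) :
    (-2 * Λ / (1 + 2 * α * lam * (1 - 3 * x)) - -2 * Λ / (1 - 4 * α * lam))
        / (6 * lam / (1 + 2 * α * lam * (1 - 3 * x)))
      = 2 * α * Λ * (1 - x) / (1 - 4 * α * lam) := by
  have hB : 1 - α * lam * 4 ≠ 0 := fun h => h1 (by linarith)
  have h6 : (6 : ℝ) * lam ≠ 0 := mul_ne_zero (by norm_num) hl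
  -- clear all denominators by hand
  have e1 : -2 * Λ / (1 + 2 * α * lam * (1 - 3 * x)) - -2 * Λ / (1 - 4 * α * lam)
      = 2 * Λ * (6 * α * lam * (1 - x)) / ((1 + 2 * α * lam * (1 - 3 * x)) * (1 - 4 * α * lam)) := by
    rw [div_sub_div _ _ hx h1]
    congr 1
    ring
  rw [e1, div_div_eq_mul_div, div_eq_div_iff h6 h1, div_mul_eq_mul_div, div_mul_eq_mul_div,
    div_eq_iff (mul_ne_zero hx h1)]
  ring

/-- **The axis denominator in drain variables**: `1 − 4αλ = m̃ + 4αΛ` with `m̃ = 1 − 4αλ₀` (normalised corner speed) and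
`Λ = λ₀ − λ` (drained mass), so the angular exponent reads `q = 2αΛ/(m̃ + 4αΛ)`. [new here — MODEL closure algebra] -/
theorem axisDenominator_drain (α lam₀ Λ : ℝ) :
    1 - 4 * α * (lam₀ - Λ) = (1 - 4 * α * lam₀) + 4 * α * Λ := by ring

/-- **`q = 1/2` for every `λ` at `α = λ₀ = 1/2`.** In the `ε → 0` limit (`m̃ = 0`, `α = 1/2`) the angular exponent
`2αΛ/(m̃ + 4αΛ)` equals `1/2` for EVERY drained mass `Λ ≠ 0`: the plateau profile is `H ∝ H_axis(s)·(sin θ)^{−1/2}` throughout the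
drain, i.e. `F = Γ_E z H ∝ (cot θ)^{1/3}` (eng-9 g2's outer law; `ElgindiStrainModeCoefficients.outerLaw_exponents`), and the
angular factor `∫Γ_E K (sin θ)^{−1/2}dθ = (3/2)B(5/6, 5/3)` of the flux is `Λ`-INDEPENDENT — the structural reason the two-ODE
closure closes. With `m̃ > 0` (finite `ε`) one has `q < 1/2`. [new here — MODEL closure algebra; LIMIT-THEORY-A §1] -/
theorem angularExponent_eq_half {Λ : ℝ} (hΛ : Λ ≠ 0) :
    2 * (1 / 2 : ℝ) * Λ / (0 + 4 * (1 / 2 : ℝ) * Λ) = 1 / 2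
      ∧ ∀ {m α : ℝ}, 0 < m → 0 < α → 0 < Λ → 2 * α * Λ / (m + 4 * α * Λ) < 1 / 2 := by
  refine ⟨by field_simp; ring, fun {m α} hm hα hΛp => ?_⟩
  rw [div_lt_iff₀ (by positivity)]
  nlinarith [mul_pos hα hΛp]

/-- **Class-E exponents of the plateau law.** At `α = 1/2`, `q = 1/2`: `F = Γ_E z H` with `Γ_E = sin^{α/3}θ cos^{2α/3}θ` and
`H ∝ (sin θ)^{−q}` has angular exponents `(α/3 − q, 2α/3) = (−1/3, 1/3)`, i.e. `F ∝ (cot θ)^{1/3}`, and the flux integrand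
`Γ_E K (sin θ)^{−q}` (`K = 3 sin θ cos²θ`) has exponents `(1 + α/3 − q, 2 + 2α/3) = (2/3, 7/3)` — the Beta integral
`(3/2)B(5/6, 5/3)`, free of `Λ`. [new here — MODEL bookkeeping] -/
theorem plateauLaw_classE_exponents :
    (1 / 2 : ℝ) / 3 - 1 / 2 = -(1 / 3) ∧ 2 * (1 / 2 : ℝ) / 3 = 1 / 3
      ∧ 1 + (1 / 2 : ℝ) / 3 - 1 / 2 = 2 / 3 ∧ 2 + 2 * (1 / 2 : ℝ) / 3 = 7 / 3
      ∧ ((2 / 3 : ℝ) + 1) / 2 = 5 / 6 ∧ ((7 / 3 : ℝ) + 1) / 2 = 5 / 3 := by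
  norm_num

/-- **`ln sin θ` in the coordinate `u = ln tan θ`**: `ln(sin(arctan(e^u))) = u − ½·ln(1 + e^{2u})`. [new here — calculus support] -/
theorem log_sin_arctan_exp (u : ℝ) :
    Real.log (Real.sin (Real.arctan (Real.exp u))) = u - (1 / 2) * Real.log (1 + Real.exp (2 * u)) := by
  rw [Real.sin_arctan]
  have hpos : 0 < 1 + Real.exp u ^ 2 := by positivity
  have hsq : Real.exp u ^ 2 = Real.exp (2 * u) := by rw [← Real.exp_nat_mul]; norm_num
  rw [Real.log_div (Real.exp_pos u).ne' (Real.sqrt_pos.mpr hpos).ne', Real.log_exp,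
    Real.log_sqrt hpos.le, hsq]
  ring

/-- **`d(ln sin θ)/du = cos²θ`**: in `u = ln tan θ`, `d/du [u − ½ ln(1 + e^{2u})] = 1/(1 + e^{2u}) = cos²(arctan e^u)`.
Together with `rateDefect_div_speed` this integrates the angular law to `y − y_axis = −q·ln sin θ`.
[new here — calculus support; LIMIT-THEORY-A §1] -/
theorem hasDerivAt_log_sin_coord (u : ℝ) :
    HasDerivAt (fun w : ℝ => w - (1 / 2) * Real.log (1 + Real.exp (2 * w))) (1 / (1 + Real.exp (2 * u))) u
      ∧ Real.cos (Real.arctan (Real.exp u)) ^ 2 = 1 / (1 + Real.exp (2 * u)) := by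
  constructor
  · have h2u : HasDerivAt (fun w : ℝ => 2 * w) 2 u := by simpa using (hasDerivAt_id' u).const_mul 2
    have hexp : HasDerivAt (fun w : ℝ => Real.exp (2 * w)) (Real.exp (2 * u) * 2) u :=
      (Real.hasDerivAt_exp (2 * u)).comp u h2u
    have hpos : 0 < 1 + Real.exp (2 * u) := by positivity
    have hlog : HasDerivAt (fun w : ℝ => Real.log (1 + Real.exp (2 * w)))
        ((Real.exp (2 * u) * 2) / (1 + Real.exp (2 * u))) u := by
      have := (hexp.const_add 1).log hpos.ne'
      simpa using this
    have h := (hasDerivAt_id' u).sub (hlog.const_mul (1 / 2))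
    refine h.congr_deriv ?_
    field_simp
    ring
  · rw [Real.cos_sq_arctan, ← Real.exp_nat_mul]; norm_num

end ElgindiDrainMatching
end Summit.NavierStokesRegularity.OSWSelfSimilar
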